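import Literature.MathematicalPhysics.QuantumFieldTheory.Balaban1983to89.B4Thm19RegionLpAll
import Literature.MathematicalPhysics.QuantumFieldTheory.Balaban1983to89.B4Thm112RegionLp
import Literature.MathematicalPhysics.QuantumFieldTheory.Balaban1983to89.B4Sect5Proof

/-!
# `Balaban1983to89.B4Thm110RegionAllF` — [Balaban1983RegularityDecay] THEOREM p. 573, INEQUALITIES (1.9)–(1.12) FOR A
# GENERAL REGION `Ω` UNDER `R₀`: «FOR AN ARBITRARY FUNCTION f» — the print's cube summation (§2 ¶1, pp. 574–575: «it is
# sufficient to prove the Proposition for a function f with support in a unit cube … the general formulation is obtained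
# by taking the decomposition f = Σ_{Δ⊂Ω} Δf and summing the inequalities») applied to r01's unit-block theorems

statement-level skeleton of published theorems with citation tags; proofs where landed; nothing here is a claim about the Yang–Mills mass gap

CITATION HEADER.  T. Bałaban, *Regularity and decay of lattice Green's functions*, Commun. Math. Phys. **89** (1983)
571–597 [Balaban1983RegularityDecay] (cell paper B4; held text `paper:balaban1983-cmp89-regularity-decay`, journal
page = PDF page + 570; pp. 573–575 read on the text layer `p0003.txt`–`p0005.txt` and the ×2 renders
`…/b2b-balaban-ref1/pages/1983-cmp89-regularity-decay/…-p003-x2.png`).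
Cell `lit-balaban` (HOME `run/shared/lean/pub/lit-balaban/`), seat `lit-balaban-r04` gens 8–9 acting as SECOND READER of
B4 (SECOND-READ-B4.md pass 5, located qualifier (q4)) on a free target of row **B4.Thm@573** (owner r01; TAKING notices
2026-08-21T21:02Z, 2026-08-22T00:04Z).  Imports ONLY r01 g7's `B4Thm19RegionLpAll` and `B4Thm112RegionLp` (hence
`B4Thm19RegionLp`, `B4Thm110RegionLpDeriv`, `B4Thm110RegionLp`) and the substrate's `B4Sect5Proof` §1 (uniform lattice
sums); no statement of those files is touched.  DOWNSTREAM: r01 g8's `B4Thm112RegionAllF` (p311046) imports THIS file and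
applies its `cubeSum_bound₂` to the δG DERIVATIVE and HÖLDER members (`thm112_deriv_region_allF`,
`thm112_holder_region_all_allF`) — those two members are therefore NOT restated here.

WHAT IS PRINTED (p. 573, verbatim): «… such that for e sufficiently small and for an arbitrary function f: Ω → R^N, we
have … |(D^η_{A,μ}G_k(Ω,A)f)(x)|, |(G_k(Ω,A)f)(x)| ≤ c₀exp(−δ₀dist(x, supp f))‖f‖_∞ (1.10) for x ∈ Ω, dist(x,Ωᶜ) ≥ R₀»;
§2 «Generalized Random Walk Representation. Proof of the Theorem», first paragraph, pp. 574–575 (verbatim, text layer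
`p0004.txt` L34–35 → `p0005.txt` L2–4): «The proof will be done in several steps in each step a reduction to a simpler
problem will be achieved. Let us notice only that it is sufficient to prove the Proposition for a function f with
support in a unit cube Δ₀ = B^k(y₀), y₀ ∈ Ω^{(k)}; the general formulation is obtained by taking the decomposition
f = Σ_{Δ⊂Ω} Δf and summing the inequalities.»  (v1.2 docfix, ref-1 g44 F4 / ref-4 S-B4-g28-1: v1.0–v1.1 carried the
paraphrase «it is sufficient to prove the theorem for function f with supports in unit cubes» in guillemets; the
mechanism formalised in §1 is exactly the printed sentence — decomposition over unit cubes and summation of the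
per-cube inequalities.)

WHAT THE TREE HAD.  r01 g7 proves (1.10) for a general `Ω` (finite union of `K`-blocks) under `R₀`, η-uniformly, in
two forms: with the bookkeeping datum `‖f‖_{2,η} ≤ V‖f‖_∞` (`thm110_value_region`, `thm110_deriv_region`) and for `f`
supported in ONE unit block (`thm110_value_region_unitBlock`, `thm110_deriv_region_unitBlock`).  THIS FILE performs the
print's elementary passage from unit-block supports to an ARBITRARY `f`:  `f = Σ_{y₀} f·1_{B(y₀)}` over the unit labels
`y₀` of `Ω`, the unit-block bound at the distance `D_{y₀} = n(|blk x − y₀|_∞ − 1)` (every fine point of `B(y₀)` is that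
far from `x` in some coordinate), and the lattice tail `Σ_{y₀} e^{−|blk x − y₀|_∞/(2K)} ≤ K_{d+1}(1/(2K))`
(`B4Sect5Proof.latticeSum_le`), using that a block meeting `supp f` has `|blk x − y₀|_∞ ≥ dist_∞(x, supp f)/n − 1`.

WHAT THIS FILE PROVES (kernel, sorry-free).
* §1 `cubeSum_bound` — the summation step for ANY matrix `M` on the fine region and any site/colour `(x, i)`: a
  unit-block bound `|(Mf)(x)_i| ≤ c₀e^{−D/(nK)}‖f‖_∞` (for every block `B(y₀)`, every `D` below the coordinate distances
  from `x` to `B(y₀)`, every `f` vanishing off `B(y₀)`) implies, for EVERY `f` vanishing off a set at `ℓ^∞`-distance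
  `≥ D` from `x`, `|(Mf)(x)_i| ≤ c₀·e^{2/K}·max(K_{d+1}(1/(2K)),1)·e^{−D/(2nK)}·‖f‖_∞`.
* §1 (cont.) `cubeSum_bound₂` — the same for an ADDITIVE functional of `f` seen from TWO base points `x₁, x₂` (the
  Hölder probe of (1.9)): unit-block bounds for `D′ ≥ 0` below the distances from both points ⇒ the bound for every
  `f` at distance `≥ D` from both, constant `c₀·2e^{2/K}·max(K_{d+1}(1/(2K)),1)`.
* §2 **`thm110_value_region_allF`**, **`thm110_deriv_region_allF`** — (1.10), value and derivative members, for a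
  GENERAL `Ω` under `R₀` and an ARBITRARY `f : Ω → ℝ^N`, with the quantifier prefix of r01's theorems verbatim
  (`∃ K ≥ 8, 8 ∣ K, ∃ c₀ > 0, ∀ (c, β), ∃ e₁ > 0, ∀ k ≥ 1, a ∈ [a₋,a₊], m² ∈ [0,m²₊], Ω, A regular (1.7), 0 < e ≤ e₁,
  x` with `R₀`, support predicate `P` at `ℓ^∞`-distance `≥ D`, `f` vanishing off `P`) and NO `V`:
  `|(G_k(Ω,A)f)(x)_i|, |(D^η_{A,μ}G_k(Ω,A)f)(x)_i| ≤ c₀·exp(−D/(2nK))·‖f‖_∞` — i.e. (1.10) with `δ₀ = 1/(2K)` per unit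
  length, `c₀` depending on what r01's `c₀` depends on (and `K`, `d`).

* §3 **`thm19_holder_region_all_allF`** — (1.9), the HÖLDER member, ALL pairs `x ≠ x′` (r01's
  `B4Thm19RegionLpAll.thm19_holder_region_all`: `0 ≤ α < 1`, `K ≥ 16`, `R₀` at both points, any nearest-neighbour
  contour `Γ` of length `≤ (d+1)|x′−x|_∞`), for an ARBITRARY `f` at `ℓ^∞`-distance `≥ D` from both points:
  `(η⁻¹/|x−x′|_∞)^α·|U(A(Γ))(D^η_{A,μ}G_kf)(x′) − (D^η_{A,μ}G_kf)(x)|_i ≤ c₀·exp(−D/(2nK))·‖f‖_∞`.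

* §4 (v1.1) **`thm112_value_region_allF`** — (1.11)–(1.12), the VALUE member, for a general PAIR `Ω ⊂ Ω₀` under `R₀` (r01's
  `B4Thm112RegionLp.thm112_value_region`), for an ARBITRARY `f` on `Ω₀`:
  `|(G_k(Ω,A)(f|_Ω))(x)_i − (G_k(Ω₀,A)f)(x)_i| ≤ c₀·e^{−(D₀+D₁)/(2nK)}·e^{−D/(4nK)}·‖f‖_∞` (`D₀ ≤ dist(x, Ω₀∖Ω)`,
  `D₁ ≤ dist(supp f, Ω₀∖Ω)`: the (1.12) factor, one distance per argument as the proof p.579 has it).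

* §5 (v1.2) **`thm112_value_region_allF'`** — §4's value member in the PRINTED single-rate shape of (1.10)+(1.12),
  `|(G_k(Ω,A)(f|_Ω))(x)_i − (G_k(Ω₀,A)f)(x)_i| ≤ c₀·e^{−(D+D₀+D₁)/(4nK)}·‖f‖_∞` — one `δ₀ = 1/(4K)` per unit length for
  `dist(x, supp f)`, `dist(x, Ωᶜ)`, `dist(supp f, Ωᶜ)` alike, and NO sign hypothesis on `D, D₀, D₁` (the separations from
  `Ω₀∖Ω` are first raised to `max(·,0)` — some coordinate difference is always `≥ 0` — and the two exponentials merged).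
  The δG DERIVATIVE and HÖLDER members for an arbitrary `f` are r01 g8's `B4Thm112RegionAllF` (p311046, on this file's
  `cubeSum_bound₂`); the same two private steps (`exists_coord_max_zero`, `exp_pair_le`) give their one-rate forms there.

HONEST SCOPE.  Exactly r01's (B4Thm110RegionLp (i)–(iii), B4Thm19RegionLp/B4Thm19RegionLpAll, B4Thm112RegionLp): abelian
one-parameter flow, component field, `K` chosen after
`(d, N, flow, L, windows)`, running coefficient `a_k = B1.aSeq a L k`, mass window; sup-metric distances in lattice
units (`D/n` = the print's distance), componentwise values.  The rate halves (`1/(2K)` for `1/K`) in the summation —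
constants are existential in the print.  Theorems only; no definition, no `Prop` fact.
v1.3 (unit `lit-balaban-r04` gen 20, DOCSTRING-ONLY; every declaration byte-identical with v1.2 p311694): the guillemets
in the docstrings of §4 `thm112_value_region_allF` and §5 `thm112_value_region_allF'` enclosed OUR corrected reading of the
δG clause; they now quote p. 573 verbatim — «we have the inequalities (1.5) and (1.6) … with the additional factor
exp(−δ₀ dist(supp f, Ωᶜ) − δ₀ dist(supp f, Ωᶜ)) (1.12)» (×2 render `…/1983-cmp89-regularity-decay-p003-x2.png`, re-read
2026-08-22; not an OCR slip) — with the forced readings (1.9)/(1.10) and dist(x,Ωᶜ) marked [sic] (SECOND-READ-B4 §16b;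
referee ref-4 S-B4-g31-1, optional rider; the tree՚s reading note D-b04.2).
-/

namespace Literature.MathematicalPhysics.QuantumFieldTheory.Balaban1983to89.B4Thm110RegionAllF

open Literature.MathematicalPhysics.QuantumFieldTheory.Balaban1983to89
open Literature.MathematicalPhysics.QuantumFieldTheory.Balaban1983to89.B4Reflection242 (blk)
open Literature.MathematicalPhysics.QuantumFieldTheory.Balaban1983to89.B4GaugeCovariance
open Literature.MathematicalPhysics.QuantumFieldTheory.Balaban1983to89.B4Lower18 (fineDom mem_fineDom IsBlockUnion)
open Literature.MathematicalPhysics.QuantumFieldTheory.Balaban1983to89.B4Lower18Regular (e1 base_le_of_blk)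
open Literature.MathematicalPhysics.QuantumFieldTheory.Balaban1983to89.B4Lemma21Region (regionOp regionDeriv)
open Literature.MathematicalPhysics.QuantumFieldTheory.Balaban1983to89.B4WalkRouteRegion (rpos)
open Literature.MathematicalPhysics.QuantumFieldTheory.Balaban1983to89.B4Thm110RegionLp (thm110_value_region_unitBlock
  lpv_two_le_unitBlock)
open Literature.MathematicalPhysics.QuantumFieldTheory.Balaban1983to89.B4Thm19RegionLpAll (thm19_holder_region_all)
open Literature.MathematicalPhysics.QuantumFieldTheory.Balaban1983to89.B4Thm112RegionLp (thm112_value_region)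
open Literature.MathematicalPhysics.QuantumFieldTheory.Balaban1983to89.B4RegionCubeCarrier (incl inReg)
open Literature.MathematicalPhysics.QuantumFieldTheory.Balaban1983to89.B4ContourShift (supNorm supNorm_nonneg)
open Literature.MathematicalPhysics.QuantumFieldTheory.Balaban1983to89.B4Lemma22HolderBox (IsNNChain)
open Literature.MathematicalPhysics.QuantumFieldTheory.Balaban1983to89.B4Eq221L2FactorRegion (acBond)
open Literature.MathematicalPhysics.QuantumFieldTheory.Balaban1983to89.B4Ineq110LpChain (lpv)
open Literature.MathematicalPhysics.QuantumFieldTheory.Balaban1983to89.B4Lemma22EtaBox (vol)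
open Literature.MathematicalPhysics.QuantumFieldTheory.Balaban1983to89.B4Thm110RegionLpDeriv
  (thm110_deriv_region_unitBlock)
open Literature.MathematicalPhysics.QuantumFieldTheory.Balaban1983to89.B4Sect5Proof (latticeConst latticeSum_le
  latticeConst_nonneg)
open scoped Matrix

noncomputable section

variable {d : ℕ} {ι : Type} [Fintype ι] [DecidableEq ι]

/-! ## §1  The cube summation (§2 ¶1, pp. 574–575) for an arbitrary matrix -/

section CubeSum

variable {n : ℕ} {Ωc : Finset (Fin (d + 1) → ℤ)}

omit [Fintype ι] [DecidableEq ι] in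
/-- Block geometry in one coordinate: for fine points `x ∈ B(b)`, `x′ ∈ B(y₀)` (blocks of side `n`),
`n(|b_μ − y₀_μ| − 1) ≤ |x_μ − x′_μ| ≤ n(|b_μ − y₀_μ| + 1)`. [folklore] -/
private theorem coord_block_bounds (hn : 1 ≤ n) {x x' b y₀ : Fin (d + 1) → ℤ} (hx : blk n x = b) (hx' : blk n x' = y₀)
    (μ : Fin (d + 1)) :
    (n : ℝ) * (|((b μ : ℤ) : ℝ) - y₀ μ| - 1) ≤ |((x μ : ℤ) : ℝ) - x' μ| ∧
      |((x μ : ℤ) : ℝ) - x' μ| ≤ (n : ℝ) * (|((b μ : ℤ) : ℝ) - y₀ μ| + 1) := by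
  obtain ⟨h1, h2⟩ := base_le_of_blk hn hx
  obtain ⟨h1', h2'⟩ := base_le_of_blk hn hx'
  have a1 : ((n : ℤ) : ℝ) * b μ ≤ x μ := by exact_mod_cast h1 μ
  have a2 : ((x μ : ℤ) : ℝ) - n * b μ ≤ n := by exact_mod_cast h2 μ
  have a1' : ((n : ℤ) : ℝ) * y₀ μ ≤ x' μ := by exact_mod_cast h1' μ
  have a2' : ((x' μ : ℤ) : ℝ) - n * y₀ μ ≤ n := by exact_mod_cast h2' μ
  have hn0 : (0 : ℝ) ≤ n := Nat.cast_nonneg n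
  push_cast at a1 a1'
  constructor
  · rw [mul_sub, mul_one]
    rcases le_or_gt (((b μ : ℤ) : ℝ)) (y₀ μ) with hle | hlt
    · rw [abs_of_nonpos (by linarith), neg_sub]
      have : (n : ℝ) * (((y₀ μ : ℤ) : ℝ) - b μ) - n ≤ ((x' μ : ℤ) : ℝ) - x μ := by nlinarith
      exact this.trans ((le_abs_self _).trans (abs_sub_comm _ _).le)
    · rw [abs_of_pos (by linarith)]
      have : (n : ℝ) * (((b μ : ℤ) : ℝ) - y₀ μ) - n ≤ ((x μ : ℤ) : ℝ) - x' μ := by nlinarith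
      exact this.trans (le_abs_self _)
  · rw [abs_le]
    constructor
    · rcases le_or_gt (((b μ : ℤ) : ℝ)) (y₀ μ) with hle | hlt
      · rw [abs_of_nonpos (by linarith)]; nlinarith
      · rw [abs_of_pos (by linarith)]; nlinarith
    · rcases le_or_gt (((b μ : ℤ) : ℝ)) (y₀ μ) with hle | hlt
      · rw [abs_of_nonpos (by linarith)]; nlinarith
      · rw [abs_of_pos (by linarith)]; nlinarith

omit [Fintype ι] [DecidableEq ι] in
/-- A coordinate attaining the sup-distance of two labels: `∃ μ, dist b y₀ ≤ |b_μ − y₀_μ|` (the `ℓ^∞` metric of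
`ℤ^{d+1}`). [folklore] -/
private theorem exists_coord_dist_le (b y₀ : Fin (d + 1) → ℤ) : ∃ μ : Fin (d + 1), dist b y₀ ≤ |((b μ : ℤ) : ℝ) - y₀ μ| := by
  obtain ⟨μ, -, hμ⟩ := Finset.exists_max_image Finset.univ (fun ν : Fin (d + 1) => |((b ν : ℤ) : ℝ) - y₀ ν|)
    Finset.univ_nonempty
  refine ⟨μ, (dist_pi_le_iff (abs_nonneg _)).2 fun ν => ?_⟩
  rw [Int.dist_eq]
  exact hμ ν (Finset.mem_univ ν)

omit [Fintype ι] [DecidableEq ι] in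
/-- `|b_ν − y₀_ν| ≤ dist b y₀`. [folklore] -/
private theorem coord_le_dist (b y₀ : Fin (d + 1) → ℤ) (ν : Fin (d + 1)) : |((b ν : ℤ) : ℝ) - y₀ ν| ≤ dist b y₀ := by
  rw [← Int.dist_eq]; exact dist_le_pi_dist b y₀ ν

omit [DecidableEq ι] in
/-- **THE CUBE SUMMATION** (§2 ¶1 pp. 574–575 «it is sufficient to prove the Proposition for a function f with
support in a unit cube … the general formulation is obtained by taking the decomposition f = Σ_{Δ⊂Ω} Δf and summing
the inequalities»): if a matrix `M` on the fine region satisfies the unit-block bound `|(Mf)(x)_i| ≤ c₀e^{−D/(nK)}‖f‖_∞` for every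
block `B(y₀)`, every `D` with `D ≤ |x_μ − x′_μ|` (some `μ`) on `B(y₀)` and every `f` vanishing off `B(y₀)`, then for
EVERY `f` vanishing off a set whose points are at `ℓ^∞`-distance `≥ D` from `x`:
`|(Mf)(x)_i| ≤ c₀·(e^{2/K}·max(K_{d+1}(1/(2K)), 1))·e^{−D/(2nK)}·‖f‖_∞`. [cite: Balaban1983RegularityDecay, §2 ¶1 pp.574–575; Theorem (1.10) p.573] -/
theorem cubeSum_bound (hn : 1 ≤ n) {K : ℝ} (hK : 0 < K) {c₀ : ℝ} (hc₀ : 0 ≤ c₀)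
    (M : Matrix (↥(fineDom n Ωc) × ι) (↥(fineDom n Ωc) × ι) ℝ) (x : ↥(fineDom n Ωc)) (i : ι)
    (hblock : ∀ (y₀ : Fin (d + 1) → ℤ) (D : ℝ),
      (∀ x' : ↥(fineDom n Ωc), blk n x'.1 = y₀ → ∃ μ, D ≤ |rpos n Ωc x μ - rpos n Ωc x' μ|) →
      ∀ f : ↥(fineDom n Ωc) × ι → ℝ, (∀ p, blk n p.1.1 ≠ y₀ → f p = 0) →
        |(M *ᵥ f) (x, i)| ≤ c₀ * Real.exp (-(D / ((n : ℝ) * K))) * ‖f‖)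
    (P : ↥(fineDom n Ωc) → Prop) (D : ℝ)
    (hD : ∀ x', P x' → ∃ μ, D ≤ |rpos n Ωc x μ - rpos n Ωc x' μ|)
    (f : ↥(fineDom n Ωc) × ι → ℝ) (hf : ∀ p, ¬ P p.1 → f p = 0) :
    |(M *ᵥ f) (x, i)| ≤ c₀ * (Real.exp (2 / K) * max (latticeConst (d + 1) (1 / (2 * K))) 1)
      * Real.exp (-(D / (2 * ((n : ℝ) * K)))) * ‖f‖ := by
  classical
  have hn0 : (0 : ℝ) < n := by exact_mod_cast hn
  set b : Fin (d + 1) → ℤ := blk n x.1 with hb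
  -- the pieces `f·1_{B(y₀)}`
  set piece : (Fin (d + 1) → ℤ) → (↥(fineDom n Ωc) × ι → ℝ) :=
    fun y₀ p => if blk n p.1.1 = y₀ then f p else 0 with hpiece
  have hdecomp : f = ∑ y₀ ∈ Ωc, piece y₀ := by
    ext p
    have hp : blk n p.1.1 ∈ Ωc := (mem_fineDom hn).1 p.1.2
    rw [Finset.sum_apply]
    simp only [hpiece]
    rw [Finset.sum_ite_eq Ωc (blk n p.1.1) (fun _ => f p), if_pos hp]
  have hpiece_off : ∀ y₀ p, blk n p.1.1 ≠ y₀ → piece y₀ p = 0 := by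
    intro y₀ p hp; simp [hpiece, hp]
  have hpiece_norm : ∀ y₀, ‖piece y₀‖ ≤ ‖f‖ := by
    intro y₀
    refine (pi_norm_le_iff_of_nonneg (norm_nonneg f)).2 fun p => ?_
    by_cases h : blk n p.1.1 = y₀
    · simp only [hpiece, if_pos h]; exact norm_le_pi_norm f p
    · simp only [hpiece, if_neg h, norm_zero]; exact norm_nonneg f
  -- the per-block bound
  set E : ℝ := c₀ * Real.exp (2 / K) * Real.exp (-(D / (2 * ((n : ℝ) * K)))) * ‖f‖ with hE
  have hE0 : 0 ≤ E := by positivity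
  have hterm : ∀ y₀ ∈ Ωc, |(M *ᵥ piece y₀) (x, i)| ≤ E * Real.exp (-(1 / (2 * K) * dist b y₀)) := by
    intro y₀ _
    by_cases hzero : ∀ p, piece y₀ p = 0
    · have : piece y₀ = 0 := funext hzero
      rw [this, Matrix.mulVec_zero, Pi.zero_apply, abs_zero]
      positivity
    push Not at hzero
    obtain ⟨p, hp⟩ := hzero
    have hpy : blk n p.1.1 = y₀ := by
      by_contra h; exact hp (hpiece_off y₀ p h)
    have hfp : f p ≠ 0 := by simpa [hpiece, hpy] using hp
    have hPp : P p.1 := by by_contra h; exact hfp (hf p h)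
    -- `D/n − 1 ≤ dist b y₀`
    obtain ⟨ν, hν⟩ := hD p.1 hPp
    have hup := (coord_block_bounds hn hb.symm hpy ν).2
    have hDle : D ≤ (n : ℝ) * (dist b y₀ + 1) := by
      have h1 : D ≤ (n : ℝ) * (|((b ν : ℤ) : ℝ) - y₀ ν| + 1) := hν.trans hup
      have h2 := coord_le_dist b y₀ ν
      nlinarith
    -- the unit-block bound at `D_{y₀} = n(dist b y₀ − 1)` along a maximising coordinate
    obtain ⟨μ, hμ⟩ := exists_coord_dist_le b y₀
    have hDy : ∀ x' : ↥(fineDom n Ωc), blk n x'.1 = y₀ →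
        ∃ μ', (n : ℝ) * (dist b y₀ - 1) ≤ |rpos n Ωc x μ' - rpos n Ωc x' μ'| := by
      intro x' hx'
      refine ⟨μ, ?_⟩
      have hlow := (coord_block_bounds hn hb.symm hx' μ).1
      have : (n : ℝ) * (dist b y₀ - 1) ≤ (n : ℝ) * (|((b μ : ℤ) : ℝ) - y₀ μ| - 1) := by gcongr
      exact this.trans hlow
    have hB := hblock y₀ _ hDy (piece y₀) (hpiece_off y₀)
    -- assemble: `c₀ e^{−(dist − 1)/K} ‖piece‖ ≤ E e^{−dist/(2K)}`
    have hexp1 : Real.exp (-((n : ℝ) * (dist b y₀ - 1) / ((n : ℝ) * K))) =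
        Real.exp (1 / K) * (Real.exp (-(1 / (2 * K) * dist b y₀)) * Real.exp (-(1 / (2 * K) * dist b y₀))) := by
      rw [← Real.exp_add, ← Real.exp_add]
      congr 1
      field_simp
      ring
    have hexp2 : Real.exp (-(1 / (2 * K) * dist b y₀)) ≤ Real.exp (1 / (2 * K)) * Real.exp (-(D / (2 * ((n : ℝ) * K)))) := by
      rw [← Real.exp_add, Real.exp_le_exp]
      have hK2 : 0 < 2 * K := by positivity
      have : D / (2 * ((n : ℝ) * K)) ≤ (dist b y₀ + 1) / (2 * K) := by
        rw [div_le_div_iff₀ (by positivity) hK2]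
        calc D * (2 * K) ≤ (n : ℝ) * (dist b y₀ + 1) * (2 * K) := by gcongr
          _ = (dist b y₀ + 1) * (2 * ((n : ℝ) * K)) := by ring
      have e1 : -(1 / (2 * K) * dist b y₀) = 1 / (2 * K) - (dist b y₀ + 1) / (2 * K) := by field_simp; ring
      rw [e1]
      linarith
    have hexp3 : Real.exp (1 / K) * Real.exp (1 / (2 * K)) ≤ Real.exp (2 / K) := by
      rw [← Real.exp_add, Real.exp_le_exp]
      have : 0 < 1 / (2 * K) := by positivity
      have e2 : 2 / K = 1 / K + 1 / (2 * K) + 1 / (2 * K) := by field_simp; ring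
      linarith
    have hd0 : 0 ≤ Real.exp (-(1 / (2 * K) * dist b y₀)) := (Real.exp_pos _).le
    calc |(M *ᵥ piece y₀) (x, i)| ≤ c₀ * Real.exp (-((n : ℝ) * (dist b y₀ - 1) / ((n : ℝ) * K))) * ‖piece y₀‖ := hB
      _ ≤ c₀ * Real.exp (-((n : ℝ) * (dist b y₀ - 1) / ((n : ℝ) * K))) * ‖f‖ := by gcongr; exact hpiece_norm y₀
      _ = c₀ * ‖f‖ * Real.exp (1 / K) * Real.exp (-(1 / (2 * K) * dist b y₀)) *
            Real.exp (-(1 / (2 * K) * dist b y₀)) := by rw [hexp1]; ring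
      _ ≤ c₀ * ‖f‖ * Real.exp (1 / K) * (Real.exp (1 / (2 * K)) * Real.exp (-(D / (2 * ((n : ℝ) * K))))) *
            Real.exp (-(1 / (2 * K) * dist b y₀)) := by gcongr
      _ = c₀ * (Real.exp (1 / K) * Real.exp (1 / (2 * K))) * Real.exp (-(D / (2 * ((n : ℝ) * K)))) * ‖f‖ *
            Real.exp (-(1 / (2 * K) * dist b y₀)) := by ring
      _ ≤ c₀ * Real.exp (2 / K) * Real.exp (-(D / (2 * ((n : ℝ) * K)))) * ‖f‖ *
            Real.exp (-(1 / (2 * K) * dist b y₀)) := by gcongr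
  -- summation over the unit labels of `Ω`
  have hsum : |(M *ᵥ f) (x, i)| ≤ ∑ y₀ ∈ Ωc, |(M *ᵥ piece y₀) (x, i)| := by
    conv_lhs => rw [hdecomp]
    rw [Matrix.mulVec_sum, Finset.sum_apply]
    exact Finset.abs_sum_le_sum_abs _ _
  have hlat := latticeSum_le (d + 1) (a := 1 / (2 * K)) (by positivity) Ωc b
  have hKd : latticeConst (d + 1) (1 / (2 * K)) ≤ max (latticeConst (d + 1) (1 / (2 * K))) 1 := le_max_left _ _
  calc |(M *ᵥ f) (x, i)| ≤ ∑ y₀ ∈ Ωc, |(M *ᵥ piece y₀) (x, i)| := hsum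
    _ ≤ ∑ y₀ ∈ Ωc, E * Real.exp (-(1 / (2 * K) * dist b y₀)) := Finset.sum_le_sum hterm
    _ = E * ∑ y₀ ∈ Ωc, Real.exp (-(1 / (2 * K) * dist b y₀)) := by rw [Finset.mul_sum]
    _ ≤ E * max (latticeConst (d + 1) (1 / (2 * K))) 1 := by gcongr; exact hlat.trans hKd
    _ = c₀ * (Real.exp (2 / K) * max (latticeConst (d + 1) (1 / (2 * K))) 1)
          * Real.exp (-(D / (2 * ((n : ℝ) * K)))) * ‖f‖ := by rw [hE]; ring

omit [DecidableEq ι] in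
/-- **THE CUBE SUMMATION FOR A LINEAR PROBE WITH TWO BASE POINTS** (§2 ¶1 pp. 574–575, for (1.9) whose left side sees `x` and
`x′`): if an additive functional `φ` of `f` obeys the unit-block bound `|φ(g)| ≤ c₀e^{−D′/(nK)}‖g‖_∞` for every block
`B(y₀)`, every `D′ ≥ 0` below the coordinate distances from BOTH `x₁` and `x₂` to `B(y₀)` and every `g` vanishing off
`B(y₀)` AND off the support predicate `P`, then for every `f` vanishing off a set at `ℓ^∞`-distance `≥ D` from both points (no sign needed on `D`):
`|φ(f)| ≤ c₀·(2e^{2/K}·max(K_{d+1}(1/(2K)), 1))·e^{−D/(2nK)}·‖f‖_∞`. [cite: Balaban1983RegularityDecay, §2 ¶1 pp.574–575; Theorem (1.9) p.573] -/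
theorem cubeSum_bound₂ (hn : 1 ≤ n) {K : ℝ} (hK : 0 < K) {c₀ : ℝ} (hc₀ : 0 ≤ c₀)
    (φ : (↥(fineDom n Ωc) × ι → ℝ) → ℝ)
    (hφ : ∀ (s : Finset (Fin (d + 1) → ℤ)) (g : (Fin (d + 1) → ℤ) → (↥(fineDom n Ωc) × ι → ℝ)),
      φ (∑ y ∈ s, g y) = ∑ y ∈ s, φ (g y))
    (x₁ x₂ : ↥(fineDom n Ωc)) (P : ↥(fineDom n Ωc) → Prop)
    (hblock : ∀ (y₀ : Fin (d + 1) → ℤ) (D : ℝ), 0 ≤ D →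
      (∀ x' : ↥(fineDom n Ωc), blk n x'.1 = y₀ → ∃ μ, D ≤ |rpos n Ωc x₁ μ - rpos n Ωc x' μ|) →
      (∀ x' : ↥(fineDom n Ωc), blk n x'.1 = y₀ → ∃ μ, D ≤ |rpos n Ωc x₂ μ - rpos n Ωc x' μ|) →
      ∀ f : ↥(fineDom n Ωc) × ι → ℝ, (∀ p, blk n p.1.1 ≠ y₀ → f p = 0) → (∀ p, ¬ P p.1 → f p = 0) →
        |φ f| ≤ c₀ * Real.exp (-(D / ((n : ℝ) * K))) * ‖f‖)
    (D : ℝ)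
    (hD₁ : ∀ x', P x' → ∃ μ, D ≤ |rpos n Ωc x₁ μ - rpos n Ωc x' μ|)
    (hD₂ : ∀ x', P x' → ∃ μ, D ≤ |rpos n Ωc x₂ μ - rpos n Ωc x' μ|)
    (f : ↥(fineDom n Ωc) × ι → ℝ) (hf : ∀ p, ¬ P p.1 → f p = 0) :
    |φ f| ≤ c₀ * (2 * Real.exp (2 / K) * max (latticeConst (d + 1) (1 / (2 * K))) 1)
      * Real.exp (-(D / (2 * ((n : ℝ) * K)))) * ‖f‖ := by
  classical
  have hn0 : (0 : ℝ) < n := by exact_mod_cast hn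
  set b₁ : Fin (d + 1) → ℤ := blk n x₁.1 with hb₁
  set b₂ : Fin (d + 1) → ℤ := blk n x₂.1 with hb₂
  set piece : (Fin (d + 1) → ℤ) → (↥(fineDom n Ωc) × ι → ℝ) :=
    fun y₀ p => if blk n p.1.1 = y₀ then f p else 0 with hpiece
  have hdecomp : f = ∑ y₀ ∈ Ωc, piece y₀ := by
    ext p
    have hp : blk n p.1.1 ∈ Ωc := (mem_fineDom hn).1 p.1.2
    rw [Finset.sum_apply]
    simp only [hpiece]
    rw [Finset.sum_ite_eq Ωc (blk n p.1.1) (fun _ => f p), if_pos hp]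
  have hpiece_off : ∀ y₀ p, blk n p.1.1 ≠ y₀ → piece y₀ p = 0 := by
    intro y₀ p hp; simp [hpiece, hp]
  have hpiece_norm : ∀ y₀, ‖piece y₀‖ ≤ ‖f‖ := by
    intro y₀
    refine (pi_norm_le_iff_of_nonneg (norm_nonneg f)).2 fun p => ?_
    by_cases h : blk n p.1.1 = y₀
    · simp only [hpiece, if_pos h]; exact norm_le_pi_norm f p
    · simp only [hpiece, if_neg h, norm_zero]; exact norm_nonneg f
  have hpiece_P : ∀ y₀ p, ¬ P p.1 → piece y₀ p = 0 := by
    intro y₀ p hp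
    by_cases h : blk n p.1.1 = y₀
    · simp only [hpiece, if_pos h]; exact hf p hp
    · simp only [hpiece, if_neg h]
  have hφ0 : φ 0 = 0 := by simpa using hφ ∅ fun _ => 0
  set E : ℝ := c₀ * Real.exp (2 / K) * Real.exp (-(D / (2 * ((n : ℝ) * K)))) * ‖f‖ with hE
  have hE0 : 0 ≤ E := by positivity
  have hterm : ∀ y₀ ∈ Ωc, |φ (piece y₀)| ≤
      E * (Real.exp (-(1 / (2 * K) * dist b₁ y₀)) + Real.exp (-(1 / (2 * K) * dist b₂ y₀))) := by
    intro y₀ _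
    by_cases hzero : ∀ p, piece y₀ p = 0
    · have : piece y₀ = 0 := funext hzero
      rw [this, hφ0, abs_zero]
      positivity
    push Not at hzero
    obtain ⟨p, hp⟩ := hzero
    have hpy : blk n p.1.1 = y₀ := by
      by_contra h; exact hp (hpiece_off y₀ p h)
    have hfp : f p ≠ 0 := by simpa [hpiece, hpy] using hp
    have hPp : P p.1 := by by_contra h; exact hfp (hf p h)
    -- `D/n − 1 ≤ m = min (dist b₁ y₀) (dist b₂ y₀)`
    set m : ℝ := min (dist b₁ y₀) (dist b₂ y₀) with hm
    have hDle₁ : D ≤ (n : ℝ) * (dist b₁ y₀ + 1) := by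
      obtain ⟨ν, hν⟩ := hD₁ p.1 hPp
      have h1 : D ≤ (n : ℝ) * (|((b₁ ν : ℤ) : ℝ) - y₀ ν| + 1) := hν.trans (coord_block_bounds hn hb₁.symm hpy ν).2
      have h2 := coord_le_dist b₁ y₀ ν
      nlinarith
    have hDle₂ : D ≤ (n : ℝ) * (dist b₂ y₀ + 1) := by
      obtain ⟨ν, hν⟩ := hD₂ p.1 hPp
      have h1 : D ≤ (n : ℝ) * (|((b₂ ν : ℤ) : ℝ) - y₀ ν| + 1) := hν.trans (coord_block_bounds hn hb₂.symm hpy ν).2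
      have h2 := coord_le_dist b₂ y₀ ν
      nlinarith
    have hDm : D ≤ (n : ℝ) * (m + 1) := by
      rcases min_choice (dist b₁ y₀) (dist b₂ y₀) with h | h <;> rw [hm, h] <;> assumption
    -- the unit-block bound at `D' = max (n(m − 1)) 0`
    set D' : ℝ := max ((n : ℝ) * (m - 1)) 0 with hD'
    obtain ⟨μ₁, hμ₁⟩ := exists_coord_dist_le b₁ y₀
    obtain ⟨μ₂, hμ₂⟩ := exists_coord_dist_le b₂ y₀
    have hm₁ : m ≤ dist b₁ y₀ := min_le_left _ _
    have hm₂ : m ≤ dist b₂ y₀ := min_le_right _ _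
    have hDy₁ : ∀ x' : ↥(fineDom n Ωc), blk n x'.1 = y₀ → ∃ μ', D' ≤ |rpos n Ωc x₁ μ' - rpos n Ωc x' μ'| := by
      intro x' hx'
      refine ⟨μ₁, max_le ?_ (abs_nonneg _)⟩
      have hlow := (coord_block_bounds hn hb₁.symm hx' μ₁).1
      have : (n : ℝ) * (m - 1) ≤ (n : ℝ) * (|((b₁ μ₁ : ℤ) : ℝ) - y₀ μ₁| - 1) := by gcongr; exact hm₁.trans hμ₁
      exact this.trans hlow
    have hDy₂ : ∀ x' : ↥(fineDom n Ωc), blk n x'.1 = y₀ → ∃ μ', D' ≤ |rpos n Ωc x₂ μ' - rpos n Ωc x' μ'| := by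
      intro x' hx'
      refine ⟨μ₂, max_le ?_ (abs_nonneg _)⟩
      have hlow := (coord_block_bounds hn hb₂.symm hx' μ₂).1
      have : (n : ℝ) * (m - 1) ≤ (n : ℝ) * (|((b₂ μ₂ : ℤ) : ℝ) - y₀ μ₂| - 1) := by gcongr; exact hm₂.trans hμ₂
      exact this.trans hlow
    have hB := hblock y₀ D' (le_max_right _ _) hDy₁ hDy₂ (piece y₀) (hpiece_off y₀) (hpiece_P y₀)
    -- `e^{−D'/(nK)} ≤ e^{1/K} e^{−m/K}` and `e^{−m/K} ≤ e^{1/(2K)} e^{−D/(2nK)} e^{−m/(2K)}`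
    have hexp1 : Real.exp (-(D' / ((n : ℝ) * K))) ≤
        Real.exp (1 / K) * (Real.exp (-(1 / (2 * K) * m)) * Real.exp (-(1 / (2 * K) * m))) := by
      rw [← Real.exp_add, ← Real.exp_add, Real.exp_le_exp]
      have h1 : (n : ℝ) * (m - 1) ≤ D' := le_max_left _ _
      have h2 : (n : ℝ) * (m - 1) / ((n : ℝ) * K) ≤ D' / ((n : ℝ) * K) :=
        div_le_div_of_nonneg_right h1 (by positivity)
      have h3 : (n : ℝ) * (m - 1) / ((n : ℝ) * K) = m / K - 1 / K := by field_simp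
      have h4 : 1 / K + (-(1 / (2 * K) * m) + -(1 / (2 * K) * m)) = -(m / K - 1 / K) := by field_simp; ring
      rw [h4]; linarith
    have hexp2 : Real.exp (-(1 / (2 * K) * m)) ≤ Real.exp (1 / (2 * K)) * Real.exp (-(D / (2 * ((n : ℝ) * K)))) := by
      rw [← Real.exp_add, Real.exp_le_exp]
      have hK2 : 0 < 2 * K := by positivity
      have : D / (2 * ((n : ℝ) * K)) ≤ (m + 1) / (2 * K) := by
        rw [div_le_div_iff₀ (by positivity) hK2]
        calc D * (2 * K) ≤ (n : ℝ) * (m + 1) * (2 * K) := by gcongr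
          _ = (m + 1) * (2 * ((n : ℝ) * K)) := by ring
      have e1 : -(1 / (2 * K) * m) = 1 / (2 * K) - (m + 1) / (2 * K) := by field_simp; ring
      rw [e1]
      linarith
    have hexp3 : Real.exp (1 / K) * Real.exp (1 / (2 * K)) ≤ Real.exp (2 / K) := by
      rw [← Real.exp_add, Real.exp_le_exp]
      have : 0 < 1 / (2 * K) := by positivity
      have e2 : 2 / K = 1 / K + 1 / (2 * K) + 1 / (2 * K) := by field_simp; ring
      linarith
    have hexp4 : Real.exp (-(1 / (2 * K) * m)) ≤
        Real.exp (-(1 / (2 * K) * dist b₁ y₀)) + Real.exp (-(1 / (2 * K) * dist b₂ y₀)) := by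
      have p₁ := Real.exp_pos (-(1 / (2 * K) * dist b₁ y₀))
      have p₂ := Real.exp_pos (-(1 / (2 * K) * dist b₂ y₀))
      rcases min_choice (dist b₁ y₀) (dist b₂ y₀) with h | h
      · rw [hm, h]; linarith
      · rw [hm, h]; linarith
    have hd0 : 0 ≤ Real.exp (-(1 / (2 * K) * m)) := (Real.exp_pos _).le
    calc |φ (piece y₀)| ≤ c₀ * Real.exp (-(D' / ((n : ℝ) * K))) * ‖piece y₀‖ := hB
      _ ≤ c₀ * (Real.exp (1 / K) * (Real.exp (-(1 / (2 * K) * m)) * Real.exp (-(1 / (2 * K) * m)))) * ‖f‖ := by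
          gcongr; exact hpiece_norm y₀
      _ ≤ c₀ * (Real.exp (1 / K) * ((Real.exp (1 / (2 * K)) * Real.exp (-(D / (2 * ((n : ℝ) * K))))) *
            Real.exp (-(1 / (2 * K) * m)))) * ‖f‖ := by gcongr
      _ = c₀ * (Real.exp (1 / K) * Real.exp (1 / (2 * K))) * Real.exp (-(D / (2 * ((n : ℝ) * K)))) * ‖f‖ *
            Real.exp (-(1 / (2 * K) * m)) := by ring
      _ ≤ c₀ * Real.exp (2 / K) * Real.exp (-(D / (2 * ((n : ℝ) * K)))) * ‖f‖ *
            (Real.exp (-(1 / (2 * K) * dist b₁ y₀)) + Real.exp (-(1 / (2 * K) * dist b₂ y₀))) := by gcongr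
  -- summation over the unit labels of `Ω`
  have hsum : |φ f| ≤ ∑ y₀ ∈ Ωc, |φ (piece y₀)| := by
    conv_lhs => rw [hdecomp, hφ]
    exact Finset.abs_sum_le_sum_abs _ _
  have hlat₁ := latticeSum_le (d + 1) (a := 1 / (2 * K)) (by positivity) Ωc b₁
  have hlat₂ := latticeSum_le (d + 1) (a := 1 / (2 * K)) (by positivity) Ωc b₂
  have hKd : latticeConst (d + 1) (1 / (2 * K)) ≤ max (latticeConst (d + 1) (1 / (2 * K))) 1 := le_max_left _ _
  calc |φ f| ≤ ∑ y₀ ∈ Ωc, |φ (piece y₀)| := hsum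
    _ ≤ ∑ y₀ ∈ Ωc, E * (Real.exp (-(1 / (2 * K) * dist b₁ y₀)) + Real.exp (-(1 / (2 * K) * dist b₂ y₀))) :=
        Finset.sum_le_sum hterm
    _ = E * (∑ y₀ ∈ Ωc, Real.exp (-(1 / (2 * K) * dist b₁ y₀)) +
          ∑ y₀ ∈ Ωc, Real.exp (-(1 / (2 * K) * dist b₂ y₀))) := by
        rw [mul_add, Finset.mul_sum, Finset.mul_sum, ← Finset.sum_add_distrib]
        exact Finset.sum_congr rfl fun _ _ => by ring
    _ ≤ E * (max (latticeConst (d + 1) (1 / (2 * K))) 1 + max (latticeConst (d + 1) (1 / (2 * K))) 1) := by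
        gcongr
        · exact hlat₁.trans hKd
        · exact hlat₂.trans hKd
    _ = c₀ * (2 * Real.exp (2 / K) * max (latticeConst (d + 1) (1 / (2 * K))) 1)
          * Real.exp (-(D / (2 * ((n : ℝ) * K)))) * ‖f‖ := by rw [hE]; ring

end CubeSum

/-! ## §2  (1.10) for a general `Ω` under `R₀`, for an ARBITRARY `f` -/

section Main

/-- **THEOREM (1.10), VALUE member, GENERAL `Ω` UNDER `R₀`, ARBITRARY `f`** — r01's `thm110_value_region_unitBlock`
summed over the unit blocks (§1): there are `K ≥ 8` (`8 ∣ K`) and `c₀ > 0` such that for every `(c, β)` there is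
`e₁ > 0` with: for every `k ≥ 1`, `a ∈ [a₋,a₊]`, `m² ∈ [0,m²₊]`, every finite union `Ω` of `K`-blocks, every vector field
regular (1.7) on `Ω` with `0 < e ≤ e₁`, every `x` with the `R₀` restriction, every support predicate `P` at
`ℓ^∞`-distance `≥ D` from `x` and EVERY `f` vanishing off `P`:
`|(G_k(Ω,A)f)(x)_i| ≤ c₀·exp(−D/(2nK))·‖f‖_∞` — «for an arbitrary function f: Ω → R^N … |(G_k(Ω,A)f)(x)| ≤
c₀exp(−δ₀dist(x, supp f))‖f‖_∞», `δ₀ = 1/(2K)` per unit length. [cite: Balaban1983RegularityDecay, Theorem p.573 (1.10); §2 ¶1 pp.574–575] -/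
theorem thm110_value_region_allF (F : OrthFlow ι) {ℓ₁ : ℝ} (hℓ₁ : 0 ≤ ℓ₁)
    (hLip : ∀ t (v : ι → ℝ), ((F.U t - 1) *ᵥ v) ⬝ᵥ ((F.U t - 1) *ᵥ v) ≤ (ℓ₁ * t) ^ 2 * (v ⬝ᵥ v))
    (d ℓ : ℕ) (hℓ : 1 ≤ ℓ) (amin aplus m2plus : ℝ) (ha : 0 < amin) :
    ∃ K : ℕ, 8 ≤ K ∧ 8 ∣ K ∧ ∃ c₀ : ℝ, 0 < c₀ ∧ ∀ (creg β : ℝ), 0 ≤ creg → 0 < β →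
      ∃ e₁ : ℝ, 0 < e₁ ∧ ∀ (k : ℕ), 1 ≤ k → ∀ (hn : 1 ≤ (ℓ + 1) ^ k) (a m2 : ℝ),
      amin ≤ a → a ≤ aplus → 0 ≤ m2 → m2 ≤ m2plus →
      ∀ (Ωc : Finset (Fin (d + 1) → ℤ)), IsBlockUnion K Ωc →
      ∀ (Ac : (Fin (d + 1) → ℤ) → Fin (d + 1) → ℝ) (e : ℝ), 0 < e → e ≤ e₁ →
        (∀ x ∈ fineDom ((ℓ + 1) ^ k) Ωc, ∀ μ ν : Fin (d + 1),
          |Ac (x + e1 μ) ν - Ac x ν| ≤ creg * e ^ (β - 1) / ((ℓ + 1) ^ k : ℕ)) →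
      ∀ (x : ↥(fineDom ((ℓ + 1) ^ k) Ωc)),
        (∀ y : Fin (d + 1) → ℤ, (∀ μ, |y μ - blk ((ℓ + 1) ^ k) x.1 μ| ≤ (K : ℤ) * (d + 3)) → y ∈ Ωc) →
      ∀ (P : ↥(fineDom ((ℓ + 1) ^ k) Ωc) → Prop) (D : ℝ),
        (∀ x', P x' → ∃ μ, D ≤ |rpos ((ℓ + 1) ^ k) Ωc x μ - rpos ((ℓ + 1) ^ k) Ωc x' μ|) →
      ∀ (f : ↥(fineDom ((ℓ + 1) ^ k) Ωc) × ι → ℝ), (∀ p, ¬ P p.1 → f p = 0) →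
      ∀ i : ι,
        |((regionOp F e hn (B1.aSeq a ((ℓ : ℝ) + 1) k) m2 Ωc Ac)⁻¹ *ᵥ f) (x, i)|
          ≤ c₀ * Real.exp (-(D / (2 * ((((ℓ + 1) ^ k : ℕ) : ℝ) * K)))) * ‖f‖ := by
  obtain ⟨K, hK8, h8, c₀, hc₀, H⟩ := thm110_value_region_unitBlock F hℓ₁ hLip d ℓ hℓ amin aplus m2plus ha
  have hK0 : (0 : ℝ) < K := by exact_mod_cast (show 0 < K by omega)
  refine ⟨K, hK8, h8, c₀ * (Real.exp (2 / K) * max (latticeConst (d + 1) (1 / (2 * K))) 1), by positivity,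
    fun creg β hcreg hβ => ?_⟩
  obtain ⟨e₁, he₁, H'⟩ := H creg β hcreg hβ
  refine ⟨e₁, he₁, ?_⟩
  intro k hk hn a m2 ha1 ha2 hm1 hm2 Ωc hΩ Ac e he hle h17 x hxR P D hD f hf i
  exact cubeSum_bound hn hK0 hc₀.le _ x i
    (fun y₀ D' hD' g hg => H' k hk hn a m2 ha1 ha2 hm1 hm2 Ωc hΩ Ac e he hle h17 x hxR y₀ D' hD' g hg i) P D hD f hf

/-- **THEOREM (1.10), DERIVATIVE member, GENERAL `Ω` UNDER `R₀`, ARBITRARY `f`** — r01's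
`thm110_deriv_region_unitBlock` summed over the unit blocks (§1): same prefix (with the `R₀` radius `K(d+3)+1` and
the bond condition `x + e_μ ∈ Ω` of the derivative member), EVERY `f` vanishing off a set at `ℓ^∞`-distance `≥ D`
from `x`: `|(D^η_{A,μ}G_k(Ω,A)f)(x)_i| ≤ c₀·exp(−D/(2nK))·‖f‖_∞`. [cite: Balaban1983RegularityDecay, Theorem p.573 (1.10); §2 ¶1 pp.574–575] -/
theorem thm110_deriv_region_allF (F : OrthFlow ι) {ℓ₁ : ℝ} (hℓ₁ : 0 ≤ ℓ₁)
    (hLip : ∀ t (v : ι → ℝ), ((F.U t - 1) *ᵥ v) ⬝ᵥ ((F.U t - 1) *ᵥ v) ≤ (ℓ₁ * t) ^ 2 * (v ⬝ᵥ v))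
    (d ℓ : ℕ) (hℓ : 1 ≤ ℓ) (amin aplus m2plus : ℝ) (ha : 0 < amin) :
    ∃ K : ℕ, 8 ≤ K ∧ 8 ∣ K ∧ ∃ c₀ : ℝ, 0 < c₀ ∧ ∀ (creg β : ℝ), 0 ≤ creg → 0 < β →
      ∃ e₁ : ℝ, 0 < e₁ ∧ ∀ (k : ℕ), 1 ≤ k → ∀ (hn : 1 ≤ (ℓ + 1) ^ k) (a m2 : ℝ),
      amin ≤ a → a ≤ aplus → 0 ≤ m2 → m2 ≤ m2plus →
      ∀ (Ωc : Finset (Fin (d + 1) → ℤ)), IsBlockUnion K Ωc →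
      ∀ (Ac : (Fin (d + 1) → ℤ) → Fin (d + 1) → ℝ) (e : ℝ), 0 < e → e ≤ e₁ →
        (∀ x ∈ fineDom ((ℓ + 1) ^ k) Ωc, ∀ μ ν : Fin (d + 1),
          |Ac (x + e1 μ) ν - Ac x ν| ≤ creg * e ^ (β - 1) / ((ℓ + 1) ^ k : ℕ)) →
      ∀ (μ : Fin (d + 1)) (x : ↥(fineDom ((ℓ + 1) ^ k) Ωc)), x.1 + e1 μ ∈ fineDom ((ℓ + 1) ^ k) Ωc →
        (∀ y : Fin (d + 1) → ℤ, (∀ ν, |y ν - blk ((ℓ + 1) ^ k) x.1 ν| ≤ (K : ℤ) * (d + 3) + 1) → y ∈ Ωc) →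
      ∀ (P : ↥(fineDom ((ℓ + 1) ^ k) Ωc) → Prop) (D : ℝ),
        (∀ x', P x' → ∃ ν, D ≤ |rpos ((ℓ + 1) ^ k) Ωc x ν - rpos ((ℓ + 1) ^ k) Ωc x' ν|) →
      ∀ (f : ↥(fineDom ((ℓ + 1) ^ k) Ωc) × ι → ℝ), (∀ p, ¬ P p.1 → f p = 0) →
      ∀ i : ι,
        |(regionDeriv F e ((ℓ + 1) ^ k) Ωc Ac μ
            *ᵥ ((regionOp F e hn (B1.aSeq a ((ℓ : ℝ) + 1) k) m2 Ωc Ac)⁻¹ *ᵥ f)) (x, i)|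
          ≤ c₀ * Real.exp (-(D / (2 * ((((ℓ + 1) ^ k : ℕ) : ℝ) * K)))) * ‖f‖ := by
  obtain ⟨K, hK8, h8, c₀, hc₀, H⟩ := thm110_deriv_region_unitBlock F hℓ₁ hLip d ℓ hℓ amin aplus m2plus ha
  have hK0 : (0 : ℝ) < K := by exact_mod_cast (show 0 < K by omega)
  refine ⟨K, hK8, h8, c₀ * (Real.exp (2 / K) * max (latticeConst (d + 1) (1 / (2 * K))) 1), by positivity,
    fun creg β hcreg hβ => ?_⟩
  obtain ⟨e₁, he₁, H'⟩ := H creg β hcreg hβ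
  refine ⟨e₁, he₁, ?_⟩
  intro k hk hn a m2 ha1 ha2 hm1 hm2 Ωc hΩ Ac e he hle h17 μ x hxμ hxR P D hD f hf i
  have key := cubeSum_bound hn hK0 hc₀.le
    (regionDeriv F e ((ℓ + 1) ^ k) Ωc Ac μ * (regionOp F e hn (B1.aSeq a ((ℓ : ℝ) + 1) k) m2 Ωc Ac)⁻¹) x i
    (fun y₀ D' hD' g hg => by
      rw [← Matrix.mulVec_mulVec]
      exact H' k hk hn a m2 ha1 ha2 hm1 hm2 Ωc hΩ Ac e he hle h17 μ x hxμ hxR y₀ D' hD' g hg i) P D hD f hf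
  rwa [← Matrix.mulVec_mulVec] at key

end Main

/-! ## §3  (1.9), the Hölder member, all pairs, general `Ω` under `R₀`, for an ARBITRARY `f` -/

section Holder

omit [DecidableEq ι] in
/-- additivity in `f` of the Hölder probe `c·((U(Γ)·(Φ_f)(x′) − (Φ_f)(x))_i)`, `Φ_f = N f`. [folklore] -/
private theorem holder_expr_sum {Y : Type} [Fintype Y] [DecidableEq ι] (c : ℝ) (T : Matrix ι ι ℝ)
    (N : Matrix (Y × ι) (Y × ι) ℝ) (x x' : Y) (i : ι) {σ : Type} (s : Finset σ) (g : σ → (Y × ι → ℝ)) :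
    c * ((T *ᵥ fld (N *ᵥ ∑ y ∈ s, g y) x' - fld (N *ᵥ ∑ y ∈ s, g y) x) i)
      = ∑ y ∈ s, c * ((T *ᵥ fld (N *ᵥ g y) x' - fld (N *ᵥ g y) x) i) := by
  classical
  have h1 : ∀ z, fld (N *ᵥ ∑ y ∈ s, g y) z = ∑ y ∈ s, fld (N *ᵥ g y) z := by
    intro z; funext j; simp [fld, Matrix.mulVec_sum, Finset.sum_apply]
  rw [h1, h1, Matrix.mulVec_sum, ← Finset.sum_sub_distrib, Finset.sum_apply, Finset.mul_sum]

/-- **THEOREM (1.9), HÖLDER member, ALL PAIRS, GENERAL `Ω` UNDER `R₀`, ARBITRARY `f`** — r01's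
`B4Thm19RegionLpAll.thm19_holder_region_all` (close pairs by the Hölder chain, far pairs by the derivative member)
freed of the bookkeeping datum `‖f‖_{2,η} ≤ V‖f‖_∞` by the two-base-point cube summation (§1): for `0 ≤ α < 1` there
are `K ≥ 16` (`8 ∣ K`) and `c₀ > 0` such that for every `(c, β)` there is `e₁ > 0` with: for every `k ≥ 1`,
`a ∈ [a₋,a₊]`, `m² ∈ [0,m²₊]`, every finite union `Ω` of `K`-blocks, every field regular (1.7) on `Ω` with
`0 < e ≤ e₁`, every direction `μ`, every pair `x ≠ x′` with both `μ`-bonds in `Ω`, every nearest-neighbour contour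
`Γ` from `x` to `x′` of length `≤ (d+1)|x′−x|_∞` inside the sup-ball, the `R₀` restriction at `x` and at `x′`, and
EVERY `f` supported at `ℓ^∞`-distance `≥ D` from both points (the print's `dist({x,x′}, supp f)`; no sign
hypothesis on `D` is needed):
`(η⁻¹/|x−x′|_∞)^α·|U(A(Γ))(D^η_{A,μ}G_k(Ω,A)f)(x′) − (D^η_{A,μ}G_k(Ω,A)f)(x)|_i ≤ c₀·e^{−D/(2nK)}·‖f‖_∞` — «for an
arbitrary function f … (1.9)». [cite: Balaban1983RegularityDecay, Theorem p.573 (1.9); §2 ¶1 pp.574–575] -/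
theorem thm19_holder_region_all_allF (F : OrthFlow ι) {ℓ₁ : ℝ} (hℓ₁ : 0 ≤ ℓ₁)
    (hLip : ∀ t (v : ι → ℝ), ((F.U t - 1) *ᵥ v) ⬝ᵥ ((F.U t - 1) *ᵥ v) ≤ (ℓ₁ * t) ^ 2 * (v ⬝ᵥ v))
    (d ℓ : ℕ) (hℓ : 1 ≤ ℓ) (amin aplus m2plus : ℝ) (ha : 0 < amin) (α : ℝ) (hα0 : 0 ≤ α) (hα1 : α < 1) :
    ∃ K : ℕ, 16 ≤ K ∧ 8 ∣ K ∧ ∃ c₀ : ℝ, 0 < c₀ ∧ ∀ (creg β : ℝ), 0 ≤ creg → 0 < β →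
      ∃ e₁ : ℝ, 0 < e₁ ∧ ∀ (k : ℕ), 1 ≤ k → ∀ (hn : 1 ≤ (ℓ + 1) ^ k) (a m2 : ℝ),
      amin ≤ a → a ≤ aplus → 0 ≤ m2 → m2 ≤ m2plus →
      ∀ (Ωc : Finset (Fin (d + 1) → ℤ)), IsBlockUnion K Ωc →
      ∀ (Ac : (Fin (d + 1) → ℤ) → Fin (d + 1) → ℝ) (e : ℝ), 0 < e → e ≤ e₁ →
        (∀ x ∈ fineDom ((ℓ + 1) ^ k) Ωc, ∀ μ ν : Fin (d + 1),
          |Ac (x + e1 μ) ν - Ac x ν| ≤ creg * e ^ (β - 1) / ((ℓ + 1) ^ k : ℕ)) →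
      ∀ (μ : Fin (d + 1)) (x x' : ↥(fineDom ((ℓ + 1) ^ k) Ωc)), x.1 + e1 μ ∈ fineDom ((ℓ + 1) ^ k) Ωc →
        x'.1 + e1 μ ∈ fineDom ((ℓ + 1) ^ k) Ωc → x'.1 ≠ x.1 →
      ∀ (l : List ↥(fineDom ((ℓ + 1) ^ k) Ωc)), IsNNChain x l → pathEnd x l = x' →
        (l.length : ℝ) ≤ ((d : ℝ) + 1) * supNorm (x'.1 - x.1) →
        (∀ z ∈ l, supNorm (z.1 - x.1) ≤ supNorm (x'.1 - x.1)) →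
        (∀ y : Fin (d + 1) → ℤ, (∀ ν, |y ν - blk ((ℓ + 1) ^ k) x.1 ν| ≤ (K : ℤ) * (d + 4)) → y ∈ Ωc) →
        (∀ y : Fin (d + 1) → ℤ, (∀ ν, |y ν - blk ((ℓ + 1) ^ k) x'.1 ν| ≤ (K : ℤ) * (d + 4)) → y ∈ Ωc) →
      ∀ (P : ↥(fineDom ((ℓ + 1) ^ k) Ωc) → Prop) (D : ℝ),
        (∀ x'', P x'' → ∃ ν, D ≤ |rpos ((ℓ + 1) ^ k) Ωc x ν - rpos ((ℓ + 1) ^ k) Ωc x'' ν|) →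
        (∀ x'', P x'' → ∃ ν, D ≤ |rpos ((ℓ + 1) ^ k) Ωc x' ν - rpos ((ℓ + 1) ^ k) Ωc x'' ν|) →
      ∀ (f : ↥(fineDom ((ℓ + 1) ^ k) Ωc) × ι → ℝ), (∀ p, ¬ P p.1 → f p = 0) →
      ∀ i : ι,
        ((((ℓ + 1) ^ k : ℕ) : ℝ) / supNorm (x'.1 - x.1)) ^ α *
          |(transport (fieldLink F (e / ((ℓ + 1) ^ k : ℕ)) (acBond Ωc Ac)) x l
              *ᵥ fld (regionDeriv F e ((ℓ + 1) ^ k) Ωc Ac μ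
                    *ᵥ ((regionOp F e hn (B1.aSeq a ((ℓ : ℝ) + 1) k) m2 Ωc Ac)⁻¹ *ᵥ f)) x'
            - fld (regionDeriv F e ((ℓ + 1) ^ k) Ωc Ac μ
                    *ᵥ ((regionOp F e hn (B1.aSeq a ((ℓ : ℝ) + 1) k) m2 Ωc Ac)⁻¹ *ᵥ f)) x) i|
          ≤ c₀ * Real.exp (-(D / (2 * ((((ℓ + 1) ^ k : ℕ) : ℝ) * K)))) * ‖f‖ := by
  classical
  obtain ⟨K, hK16, h8, c₀, hc₀, H⟩ := thm19_holder_region_all F hℓ₁ hLip d ℓ hℓ amin aplus m2plus ha α hα0 hα1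
  have hK0 : (0 : ℝ) < K := by exact_mod_cast (show 0 < K by omega)
  set V : ℝ := max (Real.sqrt (Fintype.card ι)) 1 with hV
  have hV1 : (1 : ℝ) ≤ V := le_max_right _ _
  refine ⟨K, hK16, h8, c₀ * V * (2 * Real.exp (2 / K) * max (latticeConst (d + 1) (1 / (2 * K))) 1), by positivity,
    fun creg β hcreg hβ => ?_⟩
  obtain ⟨e₁, he₁, H'⟩ := H creg β hcreg hβ
  refine ⟨e₁, he₁, ?_⟩
  intro k hk hn a m2 ha1 ha2 hm1 hm2 Ωc hΩ Ac e he hle h17 μ x x' hxμ hx'μ hne l hl hlend hlen hlnear hxR hx'R P D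
    hD₁ hD₂ f hf i
  -- the Hölder probe as an additive functional of `f`
  set T := transport (fieldLink F (e / ((ℓ + 1) ^ k : ℕ)) (acBond Ωc Ac)) x l with hT
  set N := regionDeriv F e ((ℓ + 1) ^ k) Ωc Ac μ * (regionOp F e hn (B1.aSeq a ((ℓ : ℝ) + 1) k) m2 Ωc Ac)⁻¹
    with hN
  set w : ℝ := ((((ℓ + 1) ^ k : ℕ) : ℝ) / supNorm (x'.1 - x.1)) ^ α with hw
  have hw0 : 0 ≤ w := Real.rpow_nonneg (div_nonneg (Nat.cast_nonneg _) (supNorm_nonneg _)) α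
  set φ : (↥(fineDom ((ℓ + 1) ^ k) Ωc) × ι → ℝ) → ℝ :=
    fun g => w * ((T *ᵥ fld (N *ᵥ g) x' - fld (N *ᵥ g) x) i) with hφ
  have hφabs : ∀ g, |φ g| = w * |(T *ᵥ fld (N *ᵥ g) x' - fld (N *ᵥ g) x) i| := by
    intro g; rw [hφ]; exact (abs_mul _ _).trans (by rw [abs_of_nonneg hw0])
  have hNg : ∀ g : ↥(fineDom ((ℓ + 1) ^ k) Ωc) × ι → ℝ, N *ᵥ g = regionDeriv F e ((ℓ + 1) ^ k) Ωc Ac μ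
      *ᵥ ((regionOp F e hn (B1.aSeq a ((ℓ : ℝ) + 1) k) m2 Ωc Ac)⁻¹ *ᵥ g) := by
    intro g; rw [hN, ← Matrix.mulVec_mulVec]
  have key := cubeSum_bound₂ hn hK0 (c₀ := c₀ * V) (by positivity) φ
    (fun s g => by simp only [hφ]; exact holder_expr_sum w T N x x' i s g) x x' P
    (fun y₀ D' hD0' hD1' hD2' g hg _ => by
      rw [hφabs, hNg]
      have hgV : lpv (vol d ℓ k)⁻¹ 2 g ≤ V * ‖g‖ :=
        (lpv_two_le_unitBlock hn y₀ g hg).trans (mul_le_mul_of_nonneg_right (le_max_left _ _) (norm_nonneg g))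
      have h := H' k hk hn a m2 ha1 ha2 hm1 hm2 Ωc hΩ Ac e he hle h17 μ x x' hxμ hx'μ hne l hl hlend hlen hlnear hxR hx'R
        (fun x'' => blk ((ℓ + 1) ^ k) x''.1 = y₀) D' hD0' hD1' hD2' g (fun p hp => hg p hp) V hV1 hgV i
      calc w * |(T *ᵥ fld (regionDeriv F e ((ℓ + 1) ^ k) Ωc Ac μ *ᵥ
              ((regionOp F e hn (B1.aSeq a ((ℓ : ℝ) + 1) k) m2 Ωc Ac)⁻¹ *ᵥ g)) x' -
              fld (regionDeriv F e ((ℓ + 1) ^ k) Ωc Ac μ *ᵥ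
              ((regionOp F e hn (B1.aSeq a ((ℓ : ℝ) + 1) k) m2 Ωc Ac)⁻¹ *ᵥ g)) x) i|
          ≤ c₀ * V * Real.exp (-(D' / ((((ℓ + 1) ^ k : ℕ) : ℝ) * K))) * ‖g‖ := h
        _ = c₀ * V * Real.exp (-(D' / ((((ℓ + 1) ^ k : ℕ) : ℝ) * K))) * ‖g‖ := rfl)
    D hD₁ hD₂ f hf
  rw [hφabs, hNg] at key
  calc _ ≤ c₀ * V * (2 * Real.exp (2 / K) * max (latticeConst (d + 1) (1 / (2 * K))) 1) *
        Real.exp (-(D / (2 * ((((ℓ + 1) ^ k : ℕ) : ℝ) * K)))) * ‖f‖ := key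
    _ = _ := by ring

end Holder

/-! ## §4  (1.11)–(1.12), the value member for a general PAIR `Ω ⊂ Ω₀` under `R₀`, for an ARBITRARY `f` -/

section Pair

omit [DecidableEq ι] in
/-- additivity in `f` of the `δG` probe `(G_k(Ω,A)(f|_Ω))(x)_i − (G_k(Ω₀,A)f)(ιx)_i`. [folklore] -/
private theorem pair_expr_sum {Y Y₀ : Type} [Fintype Y] [Fintype Y₀] (GΩ : Matrix (Y × ι) (Y × ι) ℝ)
    (G₀ : Matrix (Y₀ × ι) (Y₀ × ι) ℝ) (j : Y → Y₀) (x : Y) (i : ι) {σ : Type} (s : Finset σ)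
    (g : σ → (Y₀ × ι → ℝ)) :
    ((GΩ *ᵥ fun q : Y × ι => (∑ y ∈ s, g y) (j q.1, q.2)) (x, i) - (G₀ *ᵥ ∑ y ∈ s, g y) (j x, i))
      = ∑ y ∈ s, ((GΩ *ᵥ fun q : Y × ι => g y (j q.1, q.2)) (x, i) - (G₀ *ᵥ g y) (j x, i)) := by
  have h1 : (fun q : Y × ι => (∑ y ∈ s, g y) (j q.1, q.2)) = ∑ y ∈ s, fun q : Y × ι => g y (j q.1, q.2) := by
    funext q; simp [Finset.sum_apply]
  rw [h1, Matrix.mulVec_sum, Matrix.mulVec_sum, Finset.sum_apply, Finset.sum_apply, ← Finset.sum_sub_distrib]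

/-- **THEOREM (1.11)–(1.12), VALUE member, GENERAL PAIR `Ω ⊂ Ω₀` UNDER `R₀`, ARBITRARY `f`** — r01's
`B4Thm112RegionLp.thm112_value_region` freed of `‖f‖_{2,η} ≤ V‖f‖_∞` by the cube summation (§1, with the fixed
boundary factor `e^{−(D₀+D₁)/(2nK)}` carried in the constant — a block piece of `f` inherits `P`, hence `D₀`, `D₁`):
same prefix, EVERY `f` on `Ω₀` vanishing off `P` (at `ℓ^∞`-distance `≥ D` from `x`, `≥ D₁` from `Ω₀∖Ω`; `x` at distance
`≥ D₀` from `Ω₀∖Ω`):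
`|(G_k(Ω,A)(f|_Ω))(x)_i − (G_k(Ω₀,A)f)(x)_i| ≤ c₀·e^{−(D₀+D₁)/(2nK)}·e^{−D/(4nK)}·‖f‖_∞` — print: «we have the
inequalities (1.5) and (1.6) [sic; read (1.9) and (1.10), here (1.10) for δG_k(Ω,Ω₀,A)] (with the same restrictions on
x, x′) with the additional factor exp(−δ₀ dist(supp f, Ωᶜ) − δ₀ dist(supp f, Ωᶜ)) [sic; read
exp(−δ₀dist(x,Ωᶜ) − δ₀dist(supp f,Ωᶜ)), one distance per argument as the proof p. 579 has it] (1.12)», for an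
arbitrary `f`.
[cite: Balaban1983RegularityDecay, Theorem p.573 (1.11)–(1.12); §2 ¶1 pp.574–575; proof p.579] -/
theorem thm112_value_region_allF (F : OrthFlow ι) {ℓ₁ : ℝ} (hℓ₁ : 0 ≤ ℓ₁)
    (hLip : ∀ t (v : ι → ℝ), ((F.U t - 1) *ᵥ v) ⬝ᵥ ((F.U t - 1) *ᵥ v) ≤ (ℓ₁ * t) ^ 2 * (v ⬝ᵥ v))
    (d ℓ : ℕ) (hℓ : 1 ≤ ℓ) (amin aplus m2plus : ℝ) (ha : 0 < amin) :
    ∃ K : ℕ, 8 ≤ K ∧ 8 ∣ K ∧ ∃ c₀ : ℝ, 0 < c₀ ∧ ∀ (creg β : ℝ), 0 ≤ creg → 0 < β →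
      ∃ e₁ : ℝ, 0 < e₁ ∧ ∀ (k : ℕ), 1 ≤ k → ∀ (hn : 1 ≤ (ℓ + 1) ^ k) (a m2 : ℝ),
      amin ≤ a → a ≤ aplus → 0 ≤ m2 → m2 ≤ m2plus →
      ∀ (Ω₀c Ωc : Finset (Fin (d + 1) → ℤ)), IsBlockUnion K Ω₀c → IsBlockUnion K Ωc → ∀ (hsub : Ωc ⊆ Ω₀c)
      (Ac : (Fin (d + 1) → ℤ) → Fin (d + 1) → ℝ) (e : ℝ), 0 < e → e ≤ e₁ →
        (∀ x ∈ fineDom ((ℓ + 1) ^ k) Ω₀c, ∀ μ ν : Fin (d + 1),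
          |Ac (x + e1 μ) ν - Ac x ν| ≤ creg * e ^ (β - 1) / ((ℓ + 1) ^ k : ℕ)) →
      ∀ (x : ↥(fineDom ((ℓ + 1) ^ k) Ωc)),
        (∀ y : Fin (d + 1) → ℤ, (∀ μ, |y μ - blk ((ℓ + 1) ^ k) x.1 μ| ≤ (K : ℤ) * (d + 3)) → y ∈ Ωc) →
      ∀ (P : ↥(fineDom ((ℓ + 1) ^ k) Ω₀c) → Prop) (D D₀ D₁ : ℝ),
        (∀ x', P x' → ∃ μ, D ≤ |rpos ((ℓ + 1) ^ k) Ω₀c (incl hn hsub x) μ - rpos ((ℓ + 1) ^ k) Ω₀c x' μ|) →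
        (∀ x₁ : ↥(fineDom ((ℓ + 1) ^ k) Ω₀c), ¬ inReg ((ℓ + 1) ^ k) Ωc x₁ →
          ∃ μ, D₀ ≤ |rpos ((ℓ + 1) ^ k) Ω₀c (incl hn hsub x) μ - rpos ((ℓ + 1) ^ k) Ω₀c x₁ μ|) →
        (∀ x', P x' → ∀ x₁ : ↥(fineDom ((ℓ + 1) ^ k) Ω₀c), ¬ inReg ((ℓ + 1) ^ k) Ωc x₁ →
          ∃ μ, D₁ ≤ |rpos ((ℓ + 1) ^ k) Ω₀c x₁ μ - rpos ((ℓ + 1) ^ k) Ω₀c x' μ|) →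
      ∀ (f : ↥(fineDom ((ℓ + 1) ^ k) Ω₀c) × ι → ℝ), (∀ p, ¬ P p.1 → f p = 0) →
      ∀ i : ι,
        |((regionOp F e hn (B1.aSeq a ((ℓ : ℝ) + 1) k) m2 Ωc Ac)⁻¹
              *ᵥ (fun q : ↥(fineDom ((ℓ + 1) ^ k) Ωc) × ι => f (incl hn hsub q.1, q.2))) (x, i)
          - ((regionOp F e hn (B1.aSeq a ((ℓ : ℝ) + 1) k) m2 Ω₀c Ac)⁻¹ *ᵥ f) (incl hn hsub x, i)|
          ≤ c₀ * Real.exp (-((D₀ + D₁) / (2 * ((((ℓ + 1) ^ k : ℕ) : ℝ) * K))))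
            * Real.exp (-(D / (4 * ((((ℓ + 1) ^ k : ℕ) : ℝ) * K)))) * ‖f‖ := by
  classical
  obtain ⟨K, hK8, h8, c₀, hc₀, H⟩ := thm112_value_region F hℓ₁ hLip d ℓ hℓ amin aplus m2plus ha
  have hK0 : (0 : ℝ) < K := by exact_mod_cast (show 0 < K by omega)
  set V : ℝ := max (Real.sqrt (Fintype.card ι)) 1 with hV
  have hV1 : (1 : ℝ) ≤ V := le_max_right _ _
  refine ⟨K, hK8, h8, c₀ * V * (2 * Real.exp (2 / (2 * K)) * max (latticeConst (d + 1) (1 / (2 * (2 * K)))) 1),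
    by positivity, fun creg β hcreg hβ => ?_⟩
  obtain ⟨e₁, he₁, H'⟩ := H creg β hcreg hβ
  refine ⟨e₁, he₁, ?_⟩
  intro k hk hn a m2 ha1 ha2 hm1 hm2 Ω₀c Ωc hΩ₀ hΩ hsub Ac e he hle h17 x hxR P D D₀ D₁ hD hD₀ hD₁ f hf i
  have hc0 : (0 : ℝ) < (((ℓ + 1) ^ k : ℕ) : ℝ) := by exact_mod_cast hn
  set GΩ := (regionOp F e hn (B1.aSeq a ((ℓ : ℝ) + 1) k) m2 Ωc Ac)⁻¹ with hGΩ
  set G₀ := (regionOp F e hn (B1.aSeq a ((ℓ : ℝ) + 1) k) m2 Ω₀c Ac)⁻¹ with hG₀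
  set φ : (↥(fineDom ((ℓ + 1) ^ k) Ω₀c) × ι → ℝ) → ℝ := fun g =>
    (GΩ *ᵥ fun q : ↥(fineDom ((ℓ + 1) ^ k) Ωc) × ι => g (incl hn hsub q.1, q.2)) (x, i) -
      (G₀ *ᵥ g) (incl hn hsub x, i) with hφ
  -- the fixed boundary factor rides in the constant of the unit-block bound
  set E : ℝ := Real.exp (-((D₀ + D₁) / (2 * ((((ℓ + 1) ^ k : ℕ) : ℝ) * K)))) with hE
  have key := cubeSum_bound₂ hn (K := 2 * K) (by positivity) (c₀ := c₀ * V * E) (by positivity) φ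
    (fun s g => by simp only [hφ]; exact pair_expr_sum GΩ G₀ (incl hn hsub) x i s g)
    (incl hn hsub x) (incl hn hsub x) P
    (fun y₀ D' hD0' hD1' _ g hg hgP => by
      have hgV : lpv (vol d ℓ k)⁻¹ 2 g ≤ V * ‖g‖ :=
        (lpv_two_le_unitBlock hn y₀ g hg).trans (mul_le_mul_of_nonneg_right (le_max_left _ _) (norm_nonneg g))
      -- r01's theorem at the predicate `blk = y₀ ∧ P`
      have h := H' k hk hn a m2 ha1 ha2 hm1 hm2 Ω₀c Ωc hΩ₀ hΩ hsub Ac e he hle h17 x hxR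
        (fun x'' => blk ((ℓ + 1) ^ k) x''.1 = y₀ ∧ P x'') D' D₀ D₁
        (fun x'' hx'' => hD1' x'' hx''.1) hD₀ (fun x'' hx'' => hD₁ x'' hx''.2) g
        (fun p hp => by
          by_cases hb : blk ((ℓ + 1) ^ k) p.1.1 = y₀
          · exact hgP p (fun hP => hp ⟨hb, hP⟩)
          · exact hg p hb) V hV1 hgV i
      have hexp : Real.exp (-((D' + D₀ + D₁) / (2 * ((((ℓ + 1) ^ k : ℕ) : ℝ) * K)))) =
          E * Real.exp (-(D' / ((((ℓ + 1) ^ k : ℕ) : ℝ) * (2 * K)))) := by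
        rw [hE, ← Real.exp_add]; congr 1; field_simp; ring
      calc |φ g| = _ := rfl
        _ ≤ c₀ * V * Real.exp (-((D' + D₀ + D₁) / (2 * ((((ℓ + 1) ^ k : ℕ) : ℝ) * K)))) * ‖g‖ := h
        _ = c₀ * V * E * Real.exp (-(D' / ((((ℓ + 1) ^ k : ℕ) : ℝ) * (2 * K)))) * ‖g‖ := by rw [hexp]; ring)
    D hD hD f hf
  have hrate : Real.exp (-(D / (2 * ((((ℓ + 1) ^ k : ℕ) : ℝ) * (2 * K))))) =
      Real.exp (-(D / (4 * ((((ℓ + 1) ^ k : ℕ) : ℝ) * K)))) := by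
    congr 1; ring
  rw [hrate] at key
  calc |φ f| ≤ c₀ * V * E * (2 * Real.exp (2 / (2 * K)) * max (latticeConst (d + 1) (1 / (2 * (2 * K)))) 1) *
        Real.exp (-(D / (4 * ((((ℓ + 1) ^ k : ℕ) : ℝ) * K)))) * ‖f‖ := key
    _ = c₀ * V * (2 * Real.exp (2 / (2 * K)) * max (latticeConst (d + 1) (1 / (2 * (2 * K)))) 1) * E *
        Real.exp (-(D / (4 * ((((ℓ + 1) ^ k : ℕ) : ℝ) * K)))) * ‖f‖ := by ring

end Pair

/-! ## §5  (1.11)–(1.12), the value member with ONE rate, as printed: `exp(−δ₀(dist(x,supp f) + dist(x,Ωᶜ) + dist(supp f,Ωᶜ)))`, `δ₀ = 1/(4K)` per unit length (v1.2) -/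

section OneRate

omit [Fintype ι] [DecidableEq ι] in
/-- raising a separation to `0`: if some coordinate difference is `≥ D₀`, some coordinate difference is `≥ max D₀ 0`.
[folklore] -/
private theorem exists_coord_max_zero {n : ℕ} {Ωc : Finset (Fin (d + 1) → ℤ)} {D₀ : ℝ}
    {u v : ↥(fineDom n Ωc)} (h : ∃ μ, D₀ ≤ |rpos n Ωc u μ - rpos n Ωc v μ|) :
    ∃ μ, max D₀ 0 ≤ |rpos n Ωc u μ - rpos n Ωc v μ| := by
  obtain ⟨μ, hμ⟩ := h
  exact ⟨μ, max_le hμ (abs_nonneg _)⟩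

omit [Fintype ι] [DecidableEq ι] in
/-- merging the two exponential factors at the common rate `1/(4c)` after raising the separations from `Ω₀∖Ω`
to `0`: `e^{−(D₀⁺+D₁⁺)/(2c)}·e^{−D/(4c)} ≤ e^{−(D+D₀+D₁)/(4c)}`. [folklore] -/
private theorem exp_pair_le {c : ℝ} (hc : 0 < c) (D D₀ D₁ : ℝ) :
    Real.exp (-((max D₀ 0 + max D₁ 0) / (2 * c))) * Real.exp (-(D / (4 * c)))
      ≤ Real.exp (-((D + D₀ + D₁) / (4 * c))) := by
  rw [← Real.exp_add, Real.exp_le_exp]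
  have h0 : D₀ ≤ max D₀ 0 := le_max_left _ _
  have h1 : D₁ ≤ max D₁ 0 := le_max_left _ _
  have h0' : 0 ≤ max D₀ 0 := le_max_right _ _
  have h1' : 0 ≤ max D₁ 0 := le_max_right _ _
  have hc4 : 0 < 4 * c := by positivity
  have key : (D + D₀ + D₁) / (4 * c) ≤ (max D₀ 0 + max D₁ 0) / (2 * c) + D / (4 * c) := by
    rw [div_le_iff₀ hc4]
    have e : ((max D₀ 0 + max D₁ 0) / (2 * c) + D / (4 * c)) * (4 * c) = 2 * (max D₀ 0 + max D₁ 0) + D := by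
      field_simp
      ring
    rw [e]
    linarith
  linarith

/-- **(1.11)–(1.12), VALUE member, GENERAL PAIR under `R₀`, ARBITRARY `f`, ONE RATE** — `thm112_value_region_allF` in the
printed single-exponential shape «c₀exp(−δ₀dist(x, supp f))‖f‖_∞ … with the additional factor exp(−δ₀ dist(supp f, Ωᶜ)
− δ₀ dist(supp f, Ωᶜ))» [sic; read exp(−δ₀dist(x,Ωᶜ) − δ₀dist(supp f,Ωᶜ))]:
`|(G_k(Ω,A)(f|_Ω))(x)_i − (G_k(Ω₀,A)f)(x)_i| ≤ c₀·e^{−(D+D₀+D₁)/(4nK)}·‖f‖_∞`, the SAME `δ₀ = 1/(4K)`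
per unit length in all three distances, no sign hypothesis (the separations from `Ω₀∖Ω` are first raised to `0`).
[cite: Balaban1983RegularityDecay, Theorem p.573 (1.10)–(1.12); §2 ¶1 pp.574–575] -/
theorem thm112_value_region_allF' (F : OrthFlow ι) {ℓ₁ : ℝ} (hℓ₁ : 0 ≤ ℓ₁)
    (hLip : ∀ t (v : ι → ℝ), ((F.U t - 1) *ᵥ v) ⬝ᵥ ((F.U t - 1) *ᵥ v) ≤ (ℓ₁ * t) ^ 2 * (v ⬝ᵥ v))
    (d ℓ : ℕ) (hℓ : 1 ≤ ℓ) (amin aplus m2plus : ℝ) (ha : 0 < amin) :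
    ∃ K : ℕ, 8 ≤ K ∧ 8 ∣ K ∧ ∃ c₀ : ℝ, 0 < c₀ ∧ ∀ (creg β : ℝ), 0 ≤ creg → 0 < β →
      ∃ e₁ : ℝ, 0 < e₁ ∧ ∀ (k : ℕ), 1 ≤ k → ∀ (hn : 1 ≤ (ℓ + 1) ^ k) (a m2 : ℝ),
      amin ≤ a → a ≤ aplus → 0 ≤ m2 → m2 ≤ m2plus →
      ∀ (Ω₀c Ωc : Finset (Fin (d + 1) → ℤ)), IsBlockUnion K Ω₀c → IsBlockUnion K Ωc → ∀ (hsub : Ωc ⊆ Ω₀c)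
      (Ac : (Fin (d + 1) → ℤ) → Fin (d + 1) → ℝ) (e : ℝ), 0 < e → e ≤ e₁ →
        (∀ x ∈ fineDom ((ℓ + 1) ^ k) Ω₀c, ∀ μ ν : Fin (d + 1),
          |Ac (x + e1 μ) ν - Ac x ν| ≤ creg * e ^ (β - 1) / ((ℓ + 1) ^ k : ℕ)) →
      ∀ (x : ↥(fineDom ((ℓ + 1) ^ k) Ωc)),
        (∀ y : Fin (d + 1) → ℤ, (∀ μ, |y μ - blk ((ℓ + 1) ^ k) x.1 μ| ≤ (K : ℤ) * (d + 3)) → y ∈ Ωc) →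
      ∀ (P : ↥(fineDom ((ℓ + 1) ^ k) Ω₀c) → Prop) (D D₀ D₁ : ℝ),
        (∀ x', P x' → ∃ μ, D ≤ |rpos ((ℓ + 1) ^ k) Ω₀c (incl hn hsub x) μ - rpos ((ℓ + 1) ^ k) Ω₀c x' μ|) →
        (∀ x₁ : ↥(fineDom ((ℓ + 1) ^ k) Ω₀c), ¬ inReg ((ℓ + 1) ^ k) Ωc x₁ →
          ∃ μ, D₀ ≤ |rpos ((ℓ + 1) ^ k) Ω₀c (incl hn hsub x) μ - rpos ((ℓ + 1) ^ k) Ω₀c x₁ μ|) →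
        (∀ x', P x' → ∀ x₁ : ↥(fineDom ((ℓ + 1) ^ k) Ω₀c), ¬ inReg ((ℓ + 1) ^ k) Ωc x₁ →
          ∃ μ, D₁ ≤ |rpos ((ℓ + 1) ^ k) Ω₀c x₁ μ - rpos ((ℓ + 1) ^ k) Ω₀c x' μ|) →
      ∀ (f : ↥(fineDom ((ℓ + 1) ^ k) Ω₀c) × ι → ℝ), (∀ p, ¬ P p.1 → f p = 0) →
      ∀ i : ι,
        |((regionOp F e hn (B1.aSeq a ((ℓ : ℝ) + 1) k) m2 Ωc Ac)⁻¹
              *ᵥ (fun q : ↥(fineDom ((ℓ + 1) ^ k) Ωc) × ι => f (incl hn hsub q.1, q.2))) (x, i)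
          - ((regionOp F e hn (B1.aSeq a ((ℓ : ℝ) + 1) k) m2 Ω₀c Ac)⁻¹ *ᵥ f) (incl hn hsub x, i)|
          ≤ c₀ * Real.exp (-((D + D₀ + D₁) / (4 * ((((ℓ + 1) ^ k : ℕ) : ℝ) * K)))) * ‖f‖ := by
  obtain ⟨K, hK8, h8, c₀, hc₀, H⟩ := thm112_value_region_allF F hℓ₁ hLip d ℓ hℓ amin aplus m2plus ha
  have hK0 : (0 : ℝ) < K := by exact_mod_cast (show 0 < K by omega)
  refine ⟨K, hK8, h8, c₀, hc₀, fun creg β hcreg hβ => ?_⟩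
  obtain ⟨e₁, he₁, H'⟩ := H creg β hcreg hβ
  refine ⟨e₁, he₁, ?_⟩
  intro k hk hn a m2 ha1 ha2 hm1 hm2 Ω₀c Ωc hΩ₀ hΩ hsub Ac e he hle h17 x hxR P D D₀ D₁ hD hD₀ hD₁ f hf i
  have hn0 : (0 : ℝ) < (((ℓ + 1) ^ k : ℕ) : ℝ) := by exact_mod_cast hn
  have hc : (0 : ℝ) < (((ℓ + 1) ^ k : ℕ) : ℝ) * K := mul_pos hn0 hK0
  have h := H' k hk hn a m2 ha1 ha2 hm1 hm2 Ω₀c Ωc hΩ₀ hΩ hsub Ac e he hle h17 x hxR P D (max D₀ 0) (max D₁ 0) hD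
    (fun x₁ hx₁ => exists_coord_max_zero (hD₀ x₁ hx₁)) (fun x' hx' x₁ hx₁ => exists_coord_max_zero (hD₁ x' hx' x₁ hx₁))
    f hf i
  have hE := exp_pair_le hc D D₀ D₁
  refine h.trans ?_
  calc c₀ * Real.exp (-((max D₀ 0 + max D₁ 0) / (2 * ((((ℓ + 1) ^ k : ℕ) : ℝ) * K)))) * Real.exp (-(D / (4 * ((((ℓ + 1) ^ k : ℕ) : ℝ) * K)))) * ‖f‖
      = c₀ * (Real.exp (-((max D₀ 0 + max D₁ 0) / (2 * ((((ℓ + 1) ^ k : ℕ) : ℝ) * K)))) * Real.exp (-(D / (4 * ((((ℓ + 1) ^ k : ℕ) : ℝ) * K))))) * ‖f‖ := by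
        ring
    _ ≤ c₀ * Real.exp (-((D + D₀ + D₁) / (4 * ((((ℓ + 1) ^ k : ℕ) : ℝ) * K)))) * ‖f‖ := by gcongr

end OneRate

end

end Literature.MathematicalPhysics.QuantumFieldTheory.Balaban1983to89.B4Thm110RegionAllF
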